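import Mathlib
import Literature.MathematicalPhysics.QuantumLattice.WilsonDiracAP

/-!
# Volume lower bound for the free antiperiodic Wilson–Dirac symbol product
(helper for crux stmt-QuantumFields-9734, line `Sketch`, stub `stub_freeSymbolSum`)

Pure real analysis.  For the scalar symbol
`h_m(k) = (m + Σ_μ (1 − cos θ_μ))² + Σ_μ sin² θ_μ`, `θ_μ = (2 k_μ + 1) π / L`, of the free
antiperiodic `r = 1` Wilson–Dirac operator on `(ℤ/Lℤ)⁴` we prove
`∏_k h_m(k)^6 ≥ exp (−h L⁴)` for `|m| ≤ 1/4` and every `L ≥ 1`, with `h = 6 log 64`.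
Steps: (1) pointwise `h_m(k) ≥ (1 − cos θ₀)/32` (`symbol_ge`: if `Σ_μ (1 − cos θ_μ) ≥ 1/2` the
square is `≥ 1/16`, otherwise every `cos θ_μ ≥ 1/2` and `Σ sin² θ_μ ≥ Σ (1 − cos θ_μ)`);
(2) the exact one-dimensional product `∏_{j<L} 2 (1 − cos ((2j+1)π/L)) = 4`
(`prod_two_mul_one_sub_cos`), obtained by evaluating at `X = 1` the factorisation
`X^L + 1 = ∏_{j<L} (X − ζ^j α)`, `ζ = e^{2πi/L}`, `α = e^{πi/L}` (`X_pow_sub_C_eq_prod`) and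
`‖e^{ix} − 1‖ = |2 sin (x/2)|`; (3) bookkeeping: the product over `k : Fin 4 → ZMod L` of a
function of `k 0` is the `L³`-th power of the one-dimensional product, whence
`∏_k h_m(k)^6 ≥ ((4·2^{−L})^{L³} / 32^{L⁴})^6 ≥ (1/64)^{6 L⁴}`.  Mathlib only.
-/

noncomputable section

open scoped BigOperators Classical Matrix ComplexConjugate
open Finset
open Literature.MathematicalPhysics.QuantumLattice Literature.MathematicalPhysics.QuantumFieldTheory
  Literature.Probability.LatticeModels

namespace Summit.QuantumFields.QCD.Cruxes.CriticalLineDiamagnetism.ChessboardCellGain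

/-- **Pointwise lower bound for the free Wilson symbol.** For `|m| ≤ 1/4` and any four angles,
`(m + Σ_μ (1 − cos θ_μ))² + Σ_μ sin² θ_μ ≥ (1 − cos θ₀)/32`. -/
theorem symbol_ge (m : ℝ) (hm : |m| ≤ 1 / 4) (θ : Fin 4 → ℝ) :
    (1 - Real.cos (θ 0)) / 32 ≤
      (m + ∑ μ, (1 - Real.cos (θ μ))) ^ 2 + ∑ μ, Real.sin (θ μ) ^ 2 := by
  have hu : ∀ μ, 0 ≤ 1 - Real.cos (θ μ) := fun μ => sub_nonneg.2 (Real.cos_le_one _)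
  have hu2 : 1 - Real.cos (θ 0) ≤ 2 := by linarith [Real.neg_one_le_cos (θ 0)]
  have hU0 : 1 - Real.cos (θ 0) ≤ ∑ μ, (1 - Real.cos (θ μ)) :=
    Finset.single_le_sum (fun μ _ => hu μ) (Finset.mem_univ 0)
  have hS : 0 ≤ ∑ μ, Real.sin (θ μ) ^ 2 := Finset.sum_nonneg fun μ _ => sq_nonneg _
  rw [abs_le] at hm
  by_cases hU : 1 / 2 ≤ ∑ μ, (1 - Real.cos (θ μ))
  · have h1 : 1 / 4 ≤ m + ∑ μ, (1 - Real.cos (θ μ)) := by linarith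
    have hsq : 1 / 16 ≤ (m + ∑ μ, (1 - Real.cos (θ μ))) ^ 2 := by nlinarith
    linarith
  · push Not at hU
    have hsin : ∀ μ, 1 - Real.cos (θ μ) ≤ Real.sin (θ μ) ^ 2 := by
      intro μ
      have hle : 1 - Real.cos (θ μ) < 1 / 2 :=
        lt_of_le_of_lt (Finset.single_le_sum (fun ν _ => hu ν) (Finset.mem_univ μ)) hU
      rw [Real.sin_sq]
      nlinarith [hu μ]
    have hsum : ∑ μ, (1 - Real.cos (θ μ)) ≤ ∑ μ, Real.sin (θ μ) ^ 2 :=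
      Finset.sum_le_sum fun μ _ => hsin μ
    nlinarith [sq_nonneg (m + ∑ μ, (1 - Real.cos (θ μ))), hu 0]

/-- **The one-dimensional product.** For `L ≥ 1`,
`∏_{i<L} 2 (1 − cos ((2i+1)π/L)) = 4`: evaluate `X^L + 1 = ∏_{i<L} (X − ζ^i α)` (`ζ = e^{2πi/L}`,
`α = e^{πi/L}`) at `X = 1` and take squared norms, `‖1 − e^{ix}‖² = 4 sin²(x/2) = 2 (1 − cos x)`. -/
theorem prod_two_mul_one_sub_cos (L : ℕ) (hL : 0 < L) :
    ∏ i ∈ Finset.range L, 2 * (1 - Real.cos ((2 * (i : ℝ) + 1) * Real.pi / L)) = 4 := by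
  have hL0 : (L : ℂ) ≠ 0 := Nat.cast_ne_zero.2 hL.ne'
  set ζ : ℂ := Complex.exp (2 * Real.pi * Complex.I / L) with hζdef
  set α : ℂ := Complex.exp (Real.pi * Complex.I / L) with hαdef
  have hζ : IsPrimitiveRoot ζ L := Complex.isPrimitiveRoot_exp L hL.ne'
  have hα : α ^ L = -1 := by
    have h1 : (L : ℂ) * (Real.pi * Complex.I / L) = Real.pi * Complex.I := by
      field_simp
    rw [hαdef, ← Complex.exp_nat_mul, h1, Complex.exp_pi_mul_I]
  have key := X_pow_sub_C_eq_prod hζ hL hα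
  -- evaluate at `X = 1`
  have h2 : (2 : ℂ) = ∏ i ∈ Finset.range L, (1 - ζ ^ i * α) := by
    have := congrArg (Polynomial.eval 1) key
    simp only [Polynomial.eval_sub, Polynomial.eval_pow, Polynomial.eval_X, Polynomial.eval_C,
      Polynomial.eval_prod, one_pow, sub_neg_eq_add, one_add_one_eq_two] at this
    exact this
  have hroot : ∀ i : ℕ, ζ ^ i * α =
      Complex.exp (Complex.I * (((2 * (i : ℝ) + 1) * Real.pi / L : ℝ) : ℂ)) := by
    intro i
    rw [hζdef, hαdef, ← Complex.exp_nat_mul, ← Complex.exp_add]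
    congr 1
    push_cast
    field_simp
  have hnorm : ∀ i : ℕ, ‖1 - ζ ^ i * α‖ =
      |2 * Real.sin ((2 * (i : ℝ) + 1) * Real.pi / L / 2)| := by
    intro i
    rw [norm_sub_rev, hroot i, Complex.norm_exp_I_mul_ofReal_sub_one, Real.norm_eq_abs]
  have h3 : (2 : ℝ) = ∏ i ∈ Finset.range L, |2 * Real.sin ((2 * (i : ℝ) + 1) * Real.pi / L / 2)| := by
    have := congrArg (‖·‖) h2
    simp only [norm_prod, hnorm, Complex.norm_two] at this
    exact this
  calc ∏ i ∈ Finset.range L, 2 * (1 - Real.cos ((2 * (i : ℝ) + 1) * Real.pi / L))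
      = ∏ i ∈ Finset.range L, |2 * Real.sin ((2 * (i : ℝ) + 1) * Real.pi / L / 2)| ^ 2 := by
        refine Finset.prod_congr rfl fun i _ => ?_
        rw [sq_abs]
        set x : ℝ := (2 * (i : ℝ) + 1) * Real.pi / L
        have hx : Real.cos x = Real.cos (2 * (x / 2)) := by congr 1; ring
        rw [hx, Real.cos_two_mul, mul_pow, Real.sin_sq]
        ring
    _ = (∏ i ∈ Finset.range L, |2 * Real.sin ((2 * (i : ℝ) + 1) * Real.pi / L / 2)|) ^ 2 :=
        Finset.prod_pow _ _ _
    _ = 2 ^ 2 := by rw [← h3]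
    _ = 4 := by norm_num

/-- The one-dimensional product without the factors `2`:
`∏_{i<L} (1 − cos ((2i+1)π/L)) = 4 / 2^L`. -/
theorem prod_one_sub_cos_range (L : ℕ) (hL : 0 < L) :
    ∏ i ∈ Finset.range L, (1 - Real.cos ((2 * (i : ℝ) + 1) * Real.pi / L)) = 4 / 2 ^ L := by
  have h := prod_two_mul_one_sub_cos L hL
  rw [Finset.prod_mul_distrib, Finset.prod_const, Finset.card_range] at h
  rw [eq_div_iff (by positivity), mul_comm]
  exact h

/-- Reindexing a product over `ZMod L` along `ZMod.val : ZMod L → {0, …, L-1}`. -/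
theorem prod_zmod_val {M : Type*} [CommMonoid M] (L : ℕ) [NeZero L] (f : ℕ → M) :
    ∏ j : ZMod L, f j.val = ∏ i ∈ Finset.range L, f i := by
  refine Finset.prod_nbij (fun j : ZMod L => j.val) (fun j _ => Finset.mem_range.2 (ZMod.val_lt j))
    ((ZMod.val_injective L).injOn) ?_ (fun _ _ => rfl)
  intro i hi
  have hi' : i < L := by simpa using hi
  exact ⟨(i : ZMod L), by simp, ZMod.val_cast_of_lt hi'⟩

/-- The product over `Fin (n+1) → β` of a function of the `0`-th coordinate only is the
`|β|^n`-th power of the product over `β`. -/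
theorem prod_fun_apply_zero {β M : Type*} [Fintype β] [CommMonoid M] (n : ℕ) (g : β → M) :
    ∏ k : Fin (n + 1) → β, g (k 0) = (∏ b, g b) ^ (Fintype.card β ^ n) := by
  rw [← Fintype.prod_equiv (Fin.consEquiv fun _ : Fin (n + 1) => β) (fun p => g p.1)
      (fun k => g (k 0)) (fun p => by simp)]
  rw [Fintype.prod_prod_type]
  simp only [Finset.prod_const, Finset.card_univ, Fintype.card_fun, Fintype.card_fin]
  exact Finset.prod_pow _ _ _

/-- **Stub `freeSymbolSum`.** The Riemann product of the sixth power of the free antiperiodic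
Wilson–Dirac symbol is at least `exp (−h L⁴)` uniformly for `|m| ≤ 1/4`, with `h = 6 log 64`
(here written `h = −log ((1/64)^6)`), `ε = 1/4`, `L₀ = 0`. -/
theorem stub_freeSymbolSum :
    ∃ h ε : ℝ, 0 < ε ∧ ∃ L₀ : ℕ, ∀ (L : ℕ) [NeZero L], L₀ ≤ L → ∀ m : ℝ, |m| ≤ ε →
      Real.exp (-(h * (L : ℝ) ^ 4)) ≤
        ∏ k : Site 4 L,
          ((m + ∑ μ : Fin 4, (1 - Real.cos ((2 * ((k μ).val : ℝ) + 1) * Real.pi / L))) ^ 2 +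
              ∑ μ : Fin 4, Real.sin ((2 * ((k μ).val : ℝ) + 1) * Real.pi / L) ^ 2) ^ 6 := by
  refine ⟨-Real.log (((1 : ℝ) / 64) ^ 6), 1 / 4, by norm_num, 0, ?_⟩
  intro L _ _ m hm
  have hLpos : 0 < L := Nat.pos_of_ne_zero (NeZero.ne L)
  -- the angles
  set θ : Site 4 L → Fin 4 → ℝ := fun k μ => (2 * ((k μ).val : ℝ) + 1) * Real.pi / L with hθ
  -- pointwise bound
  have hpt : ∀ k : Site 4 L, (1 - Real.cos (θ k 0)) / 32 ≤
      (m + ∑ μ, (1 - Real.cos (θ k μ))) ^ 2 + ∑ μ, Real.sin (θ k μ) ^ 2 :=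
    fun k => symbol_ge m hm (θ k)
  -- the product over sites of `1 - cos θ₀`
  have hprodU : ∏ k : Site 4 L, (1 - Real.cos (θ k 0)) = (4 / 2 ^ L) ^ (L ^ 3) := by
    have h1 := prod_fun_apply_zero 3
      (fun j : ZMod L => 1 - Real.cos ((2 * (j.val : ℝ) + 1) * Real.pi / L))
    rw [ZMod.card, prod_zmod_val L (fun i : ℕ => 1 - Real.cos ((2 * (i : ℝ) + 1) * Real.pi / L)),
      prod_one_sub_cos_range L hLpos] at h1
    exact h1
  have hcard : (Finset.univ : Finset (Site 4 L)).card = L ^ 4 := by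
    rw [Finset.card_univ, Fintype.card_fun, ZMod.card, Fintype.card_fin]
  -- the numerical comparison `(1/64)^{L⁴} ≤ (4/2^L)^{L³} / 32^{L⁴}`
  have h64 : ((1 : ℝ) / 64) ^ (L ^ 4) ≤ (4 / 2 ^ L) ^ (L ^ 3) / 32 ^ (L ^ 4) := by
    have e1 : ((1 : ℝ) / 64) ^ (L ^ 4) = (((1 : ℝ) / 2) ^ L) ^ (L ^ 3) / 32 ^ (L ^ 4) := by
      rw [← pow_mul, (by ring : L * L ^ 3 = L ^ 4), ← div_pow]
      norm_num
    rw [e1]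
    gcongr
    rw [one_div_pow]
    gcongr
    norm_num
  -- the exponential
  have hexp : Real.exp (-(-Real.log (((1 : ℝ) / 64) ^ 6) * (L : ℝ) ^ 4)) =
      (((1 : ℝ) / 64) ^ (L ^ 4)) ^ 6 := by
    have e2 : -(-Real.log (((1 : ℝ) / 64) ^ 6) * (L : ℝ) ^ 4) =
        ((L ^ 4 : ℕ) : ℝ) * Real.log (((1 : ℝ) / 64) ^ 6) := by
      push_cast
      ring
    rw [e2, Real.exp_nat_mul, Real.exp_log (by positivity), pow_right_comm]
  rw [hexp]
  calc (((1 : ℝ) / 64) ^ (L ^ 4)) ^ 6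
      ≤ ((4 / 2 ^ L) ^ (L ^ 3) / 32 ^ (L ^ 4)) ^ 6 := by gcongr
    _ = (∏ k : Site 4 L, (1 - Real.cos (θ k 0)) / 32) ^ 6 := by
        rw [Finset.prod_div_distrib, hprodU, Finset.prod_const, hcard]
    _ = ∏ k : Site 4 L, ((1 - Real.cos (θ k 0)) / 32) ^ 6 := (Finset.prod_pow _ _ _).symm
    _ ≤ ∏ k : Site 4 L, ((m + ∑ μ, (1 - Real.cos (θ k μ))) ^ 2 + ∑ μ, Real.sin (θ k μ) ^ 2) ^ 6 :=
        Finset.prod_le_prod (fun k _ => by positivity) fun k _ =>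
          pow_le_pow_left₀ (div_nonneg (sub_nonneg.2 (Real.cos_le_one _)) (by norm_num)) (hpt k) 6

end Summit.QuantumFields.QCD.Cruxes.CriticalLineDiamagnetism.ChessboardCellGain

end
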